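import Mathlib
import Literature.Probability.LatticeModels.SharpnessProofs
import HarnessLib

/-!
# Box double sums of a nonnegative kernel — stub `stub_boxDoubleSumBounds`

Theorem file for stub `stub_boxDoubleSumBounds` of line `diffusive-branch-is-nonsaturation`,
crux `PrecisionLaplacian.DirectCorrelationStableTail` (stmt-CriticalPhenomena-4799).  Pure
theorem file (no definitions), Ising-free: two elementary `x`-space estimates on the box double
sums `χ₂(R) := Σ_{x, x' ∈ Λ_R} G(x' − x)` of an abstract nonnegative kernel `G` on `ℤ³`
(`Λ_R = box 3 R = {−R,…,R}³`, sup norm `‖w‖_∞ = Site.supNorm w`, spheres `∂Λ_k = sphere 3 k`).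

* (i) **Upper bound** from the infrared envelope `G(w) ≤ C₀/‖w‖_∞` (`w ≠ 0`) and `G(0) ≤ 1`:
  `χ₂(R) ≤ (54 C₀ + 2)(2R+1)⁵`.  For fixed `x ∈ Λ_R` the translate `x' ↦ x' − x` maps `Λ_R`
  injectively into `Λ_{2R}`, so `χ₂(R) ≤ (2R+1)³ Σ_{Λ_{2R}} G`; the box sum is decomposed into
  the spheres `‖w‖_∞ = k`, on which `G ≤ C₀/k` and `#∂Λ_k ≤ 6(2k+1)² ≤ 54 k²`
  (`card_sphere_succ_le`), giving `Σ_{∂Λ_k} G ≤ 54 C₀ k + 1` and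
  `Σ_{Λ_n} G ≤ (n+1)(54 C₀ n + 1)`.
* (ii) **Lower bound** from pointwise saturation `ε ≤ 3 ‖w‖_∞ G(w)` for `‖w‖_∞ ≥ N`:
  `ε (2R+1)⁵ ≤ 512 χ₂(R)` for `R ≥ 4N`, `R ≥ 4`.  With `M = ⌊R/2⌋`, `P = ⌊M/2⌋ ≥ N`: the pairs
  `x ∈ Λ_M`, `x' = w + x`, `w ∈ Λ_M` lie in `Λ_R × Λ_R`, so `χ₂(R) ≥ (2M+1)³ Σ_{Λ_M} G`; on the
  annulus `Λ_M ∖ Λ_P` (of size `(2M+1)³ − (2P+1)³ ≥ (2M+1)³ − (M+1)³`) one has `ε ≤ 3M G(w)`;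
  the remaining polynomial inequality `3M (4M+3)⁵ ≤ 512 (2M+1)³((2M+1)³ − (M+1)³)` holds
  coefficientwise.
-/

noncomputable section

namespace Summit.CriticalPhenomena.Ising3DConformalLimit.Cruxes.DirectCorrelationStableTail.DiffusiveBranchIsNonsaturation

open Finset
open Literature.Probability.LatticeModels
open scoped BigOperators

/-! ### (i) The upper bound -/

/-- For `x ∈ Λ_R` and `G ≥ 0`: `Σ_{x' ∈ Λ_R} G(x' − x) ≤ Σ_{w ∈ Λ_{2R}} G(w)` (the translate
`Λ_R − x` lies injectively in `Λ_{2R}`). [folklore] -/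
theorem boxDoubleSum_inner_le_sum_box_two_mul (G : Site 3 → ℝ) (hG : ∀ w, 0 ≤ G w) {R : ℕ}
    {x : Site 3} (hx : x ∈ box 3 R) :
    ∑ x' ∈ box 3 R, G (x' - x) ≤ ∑ w ∈ box 3 (2 * R), G w := by
  have h1 : ∑ x' ∈ box 3 R, G (x' - x) =
      ∑ w ∈ (box 3 R).map (Equiv.subRight x).toEmbedding, G w := by
    rw [Finset.sum_map]
    rfl
  rw [h1]
  refine Finset.sum_le_sum_of_subset_of_nonneg (fun w hw => ?_) (fun w _ _ => hG w)
  rw [Finset.mem_map] at hw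
  obtain ⟨x', hx', rfl⟩ := hw
  rw [mem_box] at hx hx'
  rw [mem_box]
  intro i
  have h1 := hx i
  have h2 := hx' i
  simp only [Equiv.coe_toEmbedding, Equiv.subRight_apply, Pi.sub_apply]
  push_cast
  omega

/-- Sphere sums under the infrared envelope: if `G(w) ≤ C₀/‖w‖_∞` off the origin with `C₀ ≥ 0`
and `G(0) ≤ 1`, then `Σ_{‖w‖_∞ = k} G(w) ≤ 54 C₀ k + 1` for every `k` (`k = 0`: the sphere is
`{0}`; `k = j + 1`: `#∂Λ_{j+1} ≤ 6(2j+3)² ≤ 54(j+1)²` and each term is `≤ C₀/(j+1)`). [folklore] -/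
theorem boxDoubleSum_sum_sphere_le (G : Site 3 → ℝ) {C₀ : ℝ} (hC₀ : 0 ≤ C₀)
    (hG : ∀ w : Site 3, w ≠ 0 → G w ≤ C₀ / (Site.supNorm w : ℝ)) (hG0 : G 0 ≤ 1) (k : ℕ) :
    ∑ w ∈ sphere 3 k, G w ≤ 54 * C₀ * k + 1 := by
  rcases k with _ | j
  · have h0 : sphere 3 0 = {0} := by
      ext w
      rw [mem_sphere, Finset.mem_singleton, Site.supNorm_eq_zero_iff]
    rw [h0, Finset.sum_singleton]
    simpa using hG0
  · have ht : (0 : ℝ) < ((j + 1 : ℕ) : ℝ) := by positivity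
    have hterm : ∀ w ∈ sphere 3 (j + 1), G w ≤ C₀ / ((j + 1 : ℕ) : ℝ) := by
      intro w hw
      rw [mem_sphere] at hw
      have hw0 : w ≠ 0 := fun h => by
        have := Site.supNorm_eq_zero_iff.2 h
        omega
      have := hG w hw0
      rwa [hw] at this
    have hsum : ∑ w ∈ sphere 3 (j + 1), G w ≤
        (#(sphere 3 (j + 1)) : ℝ) * (C₀ / ((j + 1 : ℕ) : ℝ)) := by
      rw [← nsmul_eq_mul]
      exact Finset.sum_le_card_nsmul _ _ _ hterm
    have hj : (0 : ℝ) ≤ j := Nat.cast_nonneg j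
    have hcard : (#(sphere 3 (j + 1)) : ℝ) ≤ 54 * ((j + 1 : ℕ) : ℝ) ^ 2 := by
      refine (card_sphere_succ_le (d := 3) j).trans ?_
      push_cast
      norm_num
      nlinarith [mul_nonneg hj hj]
    calc ∑ w ∈ sphere 3 (j + 1), G w
        ≤ (#(sphere 3 (j + 1)) : ℝ) * (C₀ / ((j + 1 : ℕ) : ℝ)) := hsum
      _ ≤ (54 * ((j + 1 : ℕ) : ℝ) ^ 2) * (C₀ / ((j + 1 : ℕ) : ℝ)) :=
          mul_le_mul_of_nonneg_right hcard (div_nonneg hC₀ ht.le)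
      _ = 54 * C₀ * ((j + 1 : ℕ) : ℝ) := by field_simp
      _ ≤ 54 * C₀ * ((j + 1 : ℕ) : ℝ) + 1 := by linarith

/-- Box sums under the infrared envelope: if `G ≥ 0`, `G(w) ≤ C₀/‖w‖_∞` off the origin with
`C₀ ≥ 0` and `G(0) ≤ 1`, then `Σ_{w ∈ Λ_n} G(w) ≤ (n+1)(54 C₀ n + 1)` (decompose `Λ_n` into the
spheres `‖w‖_∞ = k`, `k = 0,…,n`). [folklore] -/
theorem boxDoubleSum_sum_box_le (G : Site 3 → ℝ) (hGnn : ∀ w, 0 ≤ G w) {C₀ : ℝ} (hC₀ : 0 ≤ C₀)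
    (hG : ∀ w : Site 3, w ≠ 0 → G w ≤ C₀ / (Site.supNorm w : ℝ)) (hG0 : G 0 ≤ 1) (n : ℕ) :
    ∑ w ∈ box 3 n, G w ≤ (n + 1) * (54 * C₀ * n + 1) := by
  have hfib : ∑ w ∈ box 3 n, G w =
      ∑ k ∈ Finset.range (n + 1), ∑ w ∈ (box 3 n).filter (fun w => Site.supNorm w = k), G w :=
    (Finset.sum_fiberwise_of_maps_to (fun w hw => by
      have := mem_box_iff_supNorm_le.1 hw
      rw [Finset.mem_range]
      omega) _).symm
  have hfiber : ∀ k ∈ Finset.range (n + 1),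
      ∑ w ∈ (box 3 n).filter (fun w => Site.supNorm w = k), G w ≤ 54 * C₀ * n + 1 := by
    intro k hk
    have hkn : (k : ℝ) ≤ n := by exact_mod_cast Nat.lt_succ_iff.1 (Finset.mem_range.1 hk)
    calc ∑ w ∈ (box 3 n).filter (fun w => Site.supNorm w = k), G w
        ≤ ∑ w ∈ sphere 3 k, G w :=
          Finset.sum_le_sum_of_subset_of_nonneg
            (fun w hw => mem_sphere.2 (Finset.mem_filter.1 hw).2) (fun w _ _ => hGnn w)
      _ ≤ 54 * C₀ * k + 1 := boxDoubleSum_sum_sphere_le G hC₀ hG hG0 k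
      _ ≤ 54 * C₀ * n + 1 := by nlinarith [mul_le_mul_of_nonneg_left hkn hC₀]
  rw [hfib]
  calc ∑ k ∈ Finset.range (n + 1),
        ∑ w ∈ (box 3 n).filter (fun w => Site.supNorm w = k), G w
      ≤ ∑ _k ∈ Finset.range (n + 1), (54 * C₀ * n + 1 : ℝ) := Finset.sum_le_sum hfiber
    _ = (n + 1) * (54 * C₀ * n + 1) := by
        rw [Finset.sum_const, Finset.card_range, nsmul_eq_mul]
        push_cast
        ring

/-- **(i) of `stub_boxDoubleSumBounds`.**  If `G ≥ 0`, `G(w) ≤ C₀/‖w‖_∞` off the origin with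
`C₀ ≥ 0` and `G(0) ≤ 1`, then `Σ_{x, x' ∈ Λ_R} G(x' − x) ≤ (54 C₀ + 2)(2R+1)⁵`
(`≤ (2R+1)³ Σ_{Λ_{2R}} G ≤ (2R+1)⁴ (108 C₀ R + 1)`). [folklore] -/
theorem boxDoubleSum_upper (G : Site 3 → ℝ) (hGnn : ∀ w, 0 ≤ G w) {C₀ : ℝ} (hC₀ : 0 ≤ C₀)
    (hG : ∀ w : Site 3, w ≠ 0 → G w ≤ C₀ / (Site.supNorm w : ℝ)) (hG0 : G 0 ≤ 1) (R : ℕ) :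
    ∑ x ∈ box 3 R, ∑ x' ∈ box 3 R, G (x' - x) ≤ (54 * C₀ + 2) * (2 * R + 1) ^ 5 := by
  have hR : (0 : ℝ) ≤ R := Nat.cast_nonneg R
  have hS := boxDoubleSum_sum_box_le G hGnn hC₀ hG hG0 (2 * R)
  calc ∑ x ∈ box 3 R, ∑ x' ∈ box 3 R, G (x' - x)
      ≤ ∑ x ∈ box 3 R, ∑ w ∈ box 3 (2 * R), G w :=
        Finset.sum_le_sum fun x hx => boxDoubleSum_inner_le_sum_box_two_mul G hGnn hx
    _ = (2 * R + 1) ^ 3 * ∑ w ∈ box 3 (2 * R), G w := by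
        rw [Finset.sum_const, card_box, nsmul_eq_mul]
        push_cast
        ring
    _ ≤ (2 * R + 1) ^ 3 * ((((2 * R : ℕ) : ℝ) + 1) * (54 * C₀ * ((2 * R : ℕ) : ℝ) + 1)) :=
        mul_le_mul_of_nonneg_left hS (by positivity)
    _ ≤ (54 * C₀ + 2) * (2 * R + 1) ^ 5 := by
        push_cast
        have ht : (0 : ℝ) ≤ 2 * R + 1 := by positivity
        have h4 : (0 : ℝ) ≤ (2 * R + 1) ^ 4 := pow_nonneg ht 4
        have hpos : (0 : ℝ) ≤ 54 * C₀ + 4 * R + 1 := by linarith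
        nlinarith [mul_nonneg h4 hpos]

/-! ### (ii) The lower bound -/

/-- For `x ∈ Λ_M` with `2M ≤ R` and `G ≥ 0`: `Σ_{w ∈ Λ_M} G(w) ≤ Σ_{x' ∈ Λ_R} G(x' − x)` (the
sites `x' = w + x`, `w ∈ Λ_M`, lie in `Λ_R`). [folklore] -/
theorem boxDoubleSum_sum_box_le_inner (G : Site 3 → ℝ) (hG : ∀ w, 0 ≤ G w) {R M : ℕ}
    (hM : 2 * M ≤ R) {x : Site 3} (hx : x ∈ box 3 M) :
    ∑ w ∈ box 3 M, G w ≤ ∑ x' ∈ box 3 R, G (x' - x) := by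
  have h1 : ∑ w ∈ box 3 M, G w =
      ∑ x' ∈ (box 3 M).map (addRightEmbedding x), G (x' - x) := by
    rw [Finset.sum_map]
    simp
  rw [h1]
  refine Finset.sum_le_sum_of_subset_of_nonneg (fun y hy => ?_) (fun y _ _ => hG _)
  rw [Finset.mem_map] at hy
  obtain ⟨w, hw, rfl⟩ := hy
  rw [mem_box] at hx hw
  rw [mem_box]
  intro i
  have h1 := hx i
  have h2 := hw i
  have h3 : ((2 * M : ℕ) : ℤ) ≤ R := by exact_mod_cast hM
  push_cast at h3
  simp only [addRightEmbedding_apply, Pi.add_apply]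
  omega

/-- Saturation on an annulus: if `G ≥ 0` and `ε ≤ 3 ‖w‖_∞ G(w)` whenever `‖w‖_∞ ≥ N`, then for
`N ≤ P`: `#(Λ_M ∖ Λ_P) · ε ≤ 3M · Σ_{w ∈ Λ_M} G(w)` (on the annulus `P < ‖w‖_∞ ≤ M`, so
`ε ≤ 3M G(w)`). [folklore] -/
theorem boxDoubleSum_annulus (G : Site 3 → ℝ) (hG : ∀ w, 0 ≤ G w) {ε : ℝ} {N P M : ℕ}
    (hsat : ∀ w : Site 3, N ≤ Site.supNorm w → ε ≤ 3 * (Site.supNorm w : ℝ) * G w)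
    (hNP : N ≤ P) :
    (#(box 3 M \ box 3 P) : ℝ) * ε ≤ 3 * M * ∑ w ∈ box 3 M, G w := by
  calc (#(box 3 M \ box 3 P) : ℝ) * ε = ∑ _w ∈ box 3 M \ box 3 P, ε := by
        rw [Finset.sum_const, nsmul_eq_mul]
    _ ≤ ∑ w ∈ box 3 M \ box 3 P, 3 * M * G w := by
        refine Finset.sum_le_sum fun w hw => ?_
        rw [Finset.mem_sdiff, mem_box_iff_supNorm_le, mem_box_iff_supNorm_le] at hw
        have hwN : N ≤ Site.supNorm w := by omega
        have hwM : (Site.supNorm w : ℝ) ≤ M := by exact_mod_cast hw.1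
        have hGw := hG w
        calc ε ≤ 3 * (Site.supNorm w : ℝ) * G w := hsat w hwN
          _ ≤ 3 * M * G w := by nlinarith
    _ = 3 * M * ∑ w ∈ box 3 M \ box 3 P, G w := by rw [Finset.mul_sum]
    _ ≤ 3 * M * ∑ w ∈ box 3 M, G w :=
        mul_le_mul_of_nonneg_left
          (Finset.sum_le_sum_of_subset_of_nonneg Finset.sdiff_subset (fun w _ _ => hG w))
          (by positivity)

/-- **(ii) of `stub_boxDoubleSumBounds`.**  If `G ≥ 0`, `ε ≥ 0` and `ε ≤ 3 ‖w‖_∞ G(w)` whenever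
`‖w‖_∞ ≥ N`, then `ε (2R+1)⁵ ≤ 512 Σ_{x, x' ∈ Λ_R} G(x' − x)` for `R ≥ 4N`, `R ≥ 4`
(`M = ⌊R/2⌋`, `P = ⌊M/2⌋`: `χ₂(R) ≥ (2M+1)³ Σ_{Λ_M} G`, the annulus `Λ_M ∖ Λ_P` has
`≥ (2M+1)³ − (M+1)³` sites with `ε ≤ 3M G`, and `3M(4M+3)⁵ ≤ 512 (2M+1)³((2M+1)³ − (M+1)³)`).
[folklore] -/
theorem boxDoubleSum_lower (G : Site 3 → ℝ) (hG : ∀ w, 0 ≤ G w) {ε : ℝ} {N : ℕ} (hε : 0 ≤ ε)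
    (hsat : ∀ w : Site 3, N ≤ Site.supNorm w → ε ≤ 3 * (Site.supNorm w : ℝ) * G w)
    {R : ℕ} (hRN : 4 * N ≤ R) (hR4 : 4 ≤ R) :
    ε * (2 * R + 1) ^ 5 ≤ 512 * ∑ x ∈ box 3 R, ∑ x' ∈ box 3 R, G (x' - x) := by
  obtain ⟨M, hMdef⟩ : ∃ M : ℕ, M = R / 2 := ⟨_, rfl⟩
  obtain ⟨P, hPdef⟩ : ∃ P : ℕ, P = M / 2 := ⟨_, rfl⟩
  have hMR : 2 * M ≤ R := by omega
  have hRM : R ≤ 2 * M + 1 := by omega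
  have hM1 : 1 ≤ M := by omega
  have hNP : N ≤ P := by omega
  have hPM : 2 * P ≤ M := by omega
  have hPM' : P ≤ M := by omega
  -- Step 1: `χ₂(R) ≥ (2M+1)³ Σ_{Λ_M} G`.
  have h1 : (2 * (M : ℝ) + 1) ^ 3 * ∑ w ∈ box 3 M, G w ≤
      ∑ x ∈ box 3 R, ∑ x' ∈ box 3 R, G (x' - x) := by
    calc (2 * (M : ℝ) + 1) ^ 3 * ∑ w ∈ box 3 M, G w = ∑ _x ∈ box 3 M, ∑ w ∈ box 3 M, G w := by
          rw [Finset.sum_const, card_box, nsmul_eq_mul]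
          push_cast
          ring
      _ ≤ ∑ x ∈ box 3 M, ∑ x' ∈ box 3 R, G (x' - x) :=
          Finset.sum_le_sum fun x hx => boxDoubleSum_sum_box_le_inner G hG hMR hx
      _ ≤ ∑ x ∈ box 3 R, ∑ x' ∈ box 3 R, G (x' - x) :=
          Finset.sum_le_sum_of_subset_of_nonneg (box_mono 3 (by omega))
            (fun x _ _ => Finset.sum_nonneg fun x' _ => hG _)
  -- Step 2: saturation on the annulus `Λ_M ∖ Λ_P`.
  have h2 := boxDoubleSum_annulus G hG (M := M) hsat hNP
  have hcard : (#(box 3 M \ box 3 P) : ℝ) + (2 * (P : ℝ) + 1) ^ 3 = (2 * (M : ℝ) + 1) ^ 3 := by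
    have := Finset.card_sdiff_add_card_eq_card (box_mono 3 hPM')
    rw [card_box, card_box] at this
    exact_mod_cast this
  -- Step 3: the polynomial inequality.
  have hM0 : (0 : ℝ) ≤ M := Nat.cast_nonneg M
  have hM1' : (1 : ℝ) ≤ M := by exact_mod_cast hM1
  have hP' : 2 * (P : ℝ) + 1 ≤ M + 1 := by
    have : ((2 * P : ℕ) : ℝ) ≤ M := by exact_mod_cast hPM
    push_cast at this
    linarith
  have hP3 : (2 * (P : ℝ) + 1) ^ 3 ≤ ((M : ℝ) + 1) ^ 3 := pow_le_pow_left₀ (by positivity) hP' 3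
  have hR5 : (2 * (R : ℝ) + 1) ^ 5 ≤ (4 * (M : ℝ) + 3) ^ 5 := by
    have : (R : ℝ) ≤ 2 * M + 1 := by exact_mod_cast hRM
    exact pow_le_pow_left₀ (by positivity) (by linarith) 5
  have hpoly : 3 * (M : ℝ) * (4 * M + 3) ^ 5 ≤
      512 * ((2 * (M : ℝ) + 1) ^ 3 * ((2 * M + 1) ^ 3 - (M + 1) ^ 3)) := by
    nlinarith [pow_nonneg hM0 2, pow_nonneg hM0 3, pow_nonneg hM0 4, pow_nonneg hM0 5,
      pow_nonneg hM0 6]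
  have hA : (2 * (M : ℝ) + 1) ^ 3 - (M + 1) ^ 3 ≤ #(box 3 M \ box 3 P) := by linarith
  have h3M : (0 : ℝ) < 3 * M := by linarith
  have hS0 : 0 ≤ ∑ w ∈ box 3 M, G w := Finset.sum_nonneg fun w _ => hG w
  -- Step 4: combine (multiply the goal by `3M > 0`).
  refine le_of_mul_le_mul_left ?_ h3M
  calc 3 * (M : ℝ) * (ε * (2 * R + 1) ^ 5) ≤ 3 * (M : ℝ) * (ε * (4 * M + 3) ^ 5) :=
        mul_le_mul_of_nonneg_left (mul_le_mul_of_nonneg_left hR5 hε) h3M.le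
    _ = ε * (3 * (M : ℝ) * (4 * M + 3) ^ 5) := by ring
    _ ≤ ε * (512 * ((2 * (M : ℝ) + 1) ^ 3 * ((2 * M + 1) ^ 3 - (M + 1) ^ 3))) :=
        mul_le_mul_of_nonneg_left hpoly hε
    _ ≤ ε * (512 * ((2 * (M : ℝ) + 1) ^ 3 * #(box 3 M \ box 3 P))) :=
        mul_le_mul_of_nonneg_left (mul_le_mul_of_nonneg_left
          (mul_le_mul_of_nonneg_left hA (by positivity)) (by norm_num)) hε
    _ = 512 * (2 * (M : ℝ) + 1) ^ 3 * ((#(box 3 M \ box 3 P) : ℝ) * ε) := by ring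
    _ ≤ 512 * (2 * (M : ℝ) + 1) ^ 3 * (3 * M * ∑ w ∈ box 3 M, G w) :=
        mul_le_mul_of_nonneg_left h2 (by positivity)
    _ = 3 * (M : ℝ) * (512 * ((2 * (M : ℝ) + 1) ^ 3 * ∑ w ∈ box 3 M, G w)) := by ring
    _ ≤ 3 * (M : ℝ) * (512 * ∑ x ∈ box 3 R, ∑ x' ∈ box 3 R, G (x' - x)) :=
        mul_le_mul_of_nonneg_left (mul_le_mul_of_nonneg_left h1 (by norm_num)) h3M.le

/-! ### The registered stub -/

/-- **Stub `stub_boxDoubleSumBounds` (registered signature, verbatim): box double sums of a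
nonnegative kernel on `ℤ³`; Ising-free given the envelope / the saturation.**
(i) `G ≥ 0`, `G ≤ C₀/‖x‖_∞` off `0`, `G 0 ≤ 1` ⇒ `Σ_{x,x'∈Λ_R} G(x'−x) ≤ (54C₀+2)(2R+1)⁵`
(`≤ (2R+1)³ Σ_{Λ_{2R}} G`, spheres `#∂Λ_k ≤ 54k²`, `card_sphere_succ_le`).  (ii) `G ≥ 0` and
pointwise saturation `ε ≤ 3‖w‖_∞ G(w)` for `‖w‖_∞ ≥ N` ⇒ `ε (2R+1)⁵ ≤ 512 Σ_{x,x'∈Λ_R} G(x'−x)`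
for `R ≥ 4N`, `R ≥ 4` (pairs `x ∈ Λ_{⌊R/2⌋}`, `x' − x ∈ Λ_{⌊R/2⌋}`; annulus count from
`card_sdiff_add_card_eq_card` and `card_box`). [folklore] -/
theorem stub_boxDoubleSumBounds :
    ∀ (G : Site 3 → ℝ), (∀ w, 0 ≤ G w) →
      (∀ C₀ : ℝ, 0 ≤ C₀ → (∀ w : Site 3, w ≠ 0 → G w ≤ C₀ / (Site.supNorm w : ℝ)) → G 0 ≤ 1 →
        ∀ R : ℕ, ∑ x ∈ box 3 R, ∑ x' ∈ box 3 R, G (x' - x) ≤ (54 * C₀ + 2) * (2 * R + 1) ^ 5) ∧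
      (∀ (ε : ℝ) (N : ℕ), 0 ≤ ε →
        (∀ w : Site 3, N ≤ Site.supNorm w → ε ≤ 3 * (Site.supNorm w : ℝ) * G w) →
        ∀ R : ℕ, 4 * N ≤ R → 4 ≤ R →
          ε * (2 * R + 1) ^ 5 ≤ 512 * ∑ x ∈ box 3 R, ∑ x' ∈ box 3 R, G (x' - x)) :=
  fun G hG =>
    ⟨fun _C₀ hC₀ hGle hG0 R => boxDoubleSum_upper G hG hC₀ hGle hG0 R,
      fun _ε _N hε hsat _R hRN hR4 => boxDoubleSum_lower G hG hε hsat hRN hR4⟩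

end Summit.CriticalPhenomena.Ising3DConformalLimit.Cruxes.DirectCorrelationStableTail.DiffusiveBranchIsNonsaturation
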